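import Literature.Probability.Percolation.GladkovThreePointBoundUnion
import Summits.CriticalPhenomena.PercolationContinuityZ3.Theorems.PercNearOneGluingNoHeavyLowerTailThreePointHalvingTransplant
import HarnessLib

/-!
# The three-point HALVING LEMMA (v) in the Gladkov regime `P(s ↔ c) ≤ 3 − 2√2` (Sahi programme, prover prim-sahi-p2 gen 45)

Support file (`--supports stmt-CriticalPhenomena-4575`, helper).  No definitions, no named facts, no sorries; standard axioms.
Memo `run/shared/lean/prim/prim-sahi/FROM-prim-sahi-p2-gen45-PARALLEL-CLOSURE.md`; `prim-sahi-p2/PROOF-E3.md` §55.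

SETTING.  Bernoulli bond percolation `μ = prodBernoulli w` with arbitrary pair weights on a finite vertex type `V`; three vertices
`s, a, c`; `U = {s ↔ a} ∪ {c ↔ a}` ("`a` is joined to `s` or to `c`"), `D = {s ↮ c}`, `J = U ∩ {s ↔ c} = {s ↔ a} ∩ {s ↔ c}` (all three
joined), `T = μ(J)`, `u = μ(U)`, `σ = μ(s ↔ c)`.  The HALVING LEMMA (v) of the C5-chord line (memos gen 42–44, `…ThreePointHalvingTransplant`)
is `μ(U)·μ(D) ≤ 2·μ(U ∩ D)`, equivalently `2T ≤ (1 + σ)·u` (`halvingUD_iff_two_J_le`), equivalently the cell form `T·p₀ ≤ (1+p₃)(p₁+p₂)`.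
It is OPEN in general (0 violations anywhere; adversarial infimum of `μ(U ∩ D)/(μ(U)μ(D))` is `0.835…`).

WHAT IS PROVED HERE (every finite weighted graph, every `s a c`).
* `halvingUD_of_sq_J_le` — if `T² ≤ 2u²σ` and `8σ ≤ (1+σ)²` then (v).  Pure algebra: `4T² ≤ 8u²σ ≤ u²(1+σ)²`, so `2T ≤ u(1+σ)`.
* **`halvingUD_of_openConn_le`** — (v) holds on every weighted graph with `μ(s ↔ c) ≤ 3 − 2√2 ≈ 0.1716`: the first hypothesis is GLADKOV's
  inequality (14), `P(abc)² ≤ 2·P(ab ∪ ac)²·P(bc)` [cite: Gladkov2024, Thm. 6.2 (14) (p. 8), proof §6.2 (p. 9)] (tree: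
  `gladkov2024_thm_6_2_ineq14_prodBernoulli'`, with Gladkov's `a, b, c` = our `a, s, c`), and `σ ≤ 3 − 2√2` gives `σ² − 6σ + 1 ≥ 0`, i.e.
  `8σ ≤ (1+σ)²`.  Rational corollary `halvingUD_of_openConn_le_sixth` (`σ ≤ 1/6`).
* `halving_cells_of_openConn_le` — the same in the cell form `T·p₀ ≤ (1 + p₃)·(p₁ + p₂)` of `…ThreePointHalvingTransplant`.
So the halving lemma is settled in the regime where `s` and `c` are joined with probability at most `3 − 2√2`; the open regime is
`μ(s ↔ c) > 3 − 2√2` (the adversarial extremal families `K_{2,k}`, `H_k` live at `σ ≈ 1/2 … 1`; they are settled by the parallel-closure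
theorem of `…ThreePointHalvingParallel`).
-/

noncomputable section

open Classical

namespace Summit.CriticalPhenomena.PercolationContinuityZ3.Theorems

namespace HalvingRegime

open MeasureTheory
open Literature.Probability.Percolation Literature.Probability.LatticeModels

variable {V : Type*} [Fintype V]

/-- **The two forms of (v).**  With `U = {s↔a} ∪ {c↔a}`, `D = {s↮c}`: `μ(U)·μ(D) ≤ 2·μ(U ∩ D)` iff
`2·μ({s↔a} ∩ {s↔c}) ≤ (1 + μ{s↔c})·μ(U)` (because `μ(U ∩ D) = μ(U) − μ(U ∩ {s↔c})` and `U ∩ {s↔c} = {s↔a} ∩ {s↔c}`). [this work] -/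
theorem halvingUD_iff_two_J_le (w : Sym2 V → unitInterval) (s a c : V) :
    (prodBernoulli w).real (openConn s a ∪ openConn c a) * (prodBernoulli w).real ((openConn s c)ᶜ) ≤
        2 * (prodBernoulli w).real ((openConn s a ∪ openConn c a) ∩ (openConn s c)ᶜ) ↔
      2 * (prodBernoulli w).real (openConn s a ∩ openConn s c) ≤
        (1 + (prodBernoulli w).real (openConn s c)) * (prodBernoulli w).real (openConn s a ∪ openConn c a) := by
  set μ := prodBernoulli w with hμ
  have hU : μ.real (openConn s a ∪ openConn c a) =
      μ.real ((openConn s a ∪ openConn c a) ∩ (openConn s c)ᶜ) + μ.real (openConn s a ∩ openConn s c) := by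
    rw [← HalvingTransplant.inter_Dc_eq_J s a c,
      ← measureReal_inter_add_sdiff₀ (s := openConn s a ∪ openConn c a) (t := (openConn s c)ᶜ)
      (MeasurableSet.of_discrete).nullMeasurableSet]
    congr 2
    ext ω; simp only [Set.mem_sdiff, Set.mem_compl_iff, not_not, Set.mem_inter_iff]
  have hD : μ.real ((openConn s c)ᶜ) = 1 - μ.real (openConn s c) := by
    rw [measureReal_compl MeasurableSet.of_discrete, probReal_univ]
  rw [hU, hD]
  constructor <;> intro h <;> nlinarith [h]

/-- **Algebraic core.**  If `T² ≤ 2·u²·σ` (Gladkov (14)) and `8σ ≤ (1+σ)²` then `2T ≤ (1+σ)·u`, for reals `u, σ ≥ 0`. [this work] -/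
theorem two_mul_le_of_sq_le {T u σ : ℝ} (hu : 0 ≤ u) (hσ : 0 ≤ σ) (h14 : T ^ 2 ≤ 2 * u ^ 2 * σ)
    (hreg : 8 * σ ≤ (1 + σ) ^ 2) : 2 * T ≤ (1 + σ) * u := by
  have h4 : (2 * T) ^ 2 ≤ ((1 + σ) * u) ^ 2 := by nlinarith [sq_nonneg u]
  have hpos : 0 ≤ (1 + σ) * u := by positivity
  exact abs_le_of_sq_le_sq' h4 hpos |>.2

/-- `σ ≤ 3 − 2√2` gives the regime inequality `8σ ≤ (1+σ)²` (the roots of `σ² − 6σ + 1` are `3 ± 2√2`). [this work] -/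
theorem eight_mul_le_of_le_three_sub (σ : ℝ) (hσ : σ ≤ 3 - 2 * Real.sqrt 2) : 8 * σ ≤ (1 + σ) ^ 2 := by
  have h2 : Real.sqrt 2 ^ 2 = 2 := Real.sq_sqrt (by norm_num)
  have hs0 : 0 ≤ Real.sqrt 2 := Real.sqrt_nonneg 2
  have ha : 0 ≤ 3 - 2 * Real.sqrt 2 - σ := by linarith
  have hb : 0 ≤ 3 + 2 * Real.sqrt 2 - σ := by nlinarith
  have hprod : 0 ≤ (3 - 2 * Real.sqrt 2 - σ) * (3 + 2 * Real.sqrt 2 - σ) := mul_nonneg ha hb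
  nlinarith [hprod, h2]

/-- `σ ≤ 1/6` also gives `8σ ≤ (1+σ)²` (a rational threshold inside the regime: `1/6 < 3 − 2√2`). [this work] -/
theorem eight_mul_le_of_le_sixth (σ : ℝ) (hσ : σ ≤ 1 / 6) : 8 * σ ≤ (1 + σ) ^ 2 := by
  nlinarith [sq_nonneg (σ - 1 / 6)]

/-- **(v) from a Gladkov-(14)-type bound and the regime inequality** (`U = {s↔a} ∪ {c↔a}`, `D = {s↮c}`). [this work] -/
theorem halvingUD_of_sq_J_le (w : Sym2 V → unitInterval) (s a c : V)
    (h14 : ((prodBernoulli w).real (openConn s a ∩ openConn s c)) ^ 2 ≤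
      2 * ((prodBernoulli w).real (openConn s a ∪ openConn c a)) ^ 2 * (prodBernoulli w).real (openConn s c))
    (hreg : 8 * (prodBernoulli w).real (openConn s c) ≤ (1 + (prodBernoulli w).real (openConn s c)) ^ 2) :
    (prodBernoulli w).real (openConn s a ∪ openConn c a) * (prodBernoulli w).real ((openConn s c)ᶜ) ≤
      2 * (prodBernoulli w).real ((openConn s a ∪ openConn c a) ∩ (openConn s c)ᶜ) := by
  rw [halvingUD_iff_two_J_le]
  exact two_mul_le_of_sq_le measureReal_nonneg measureReal_nonneg h14 hreg

/-- Gladkov's inequality (14) in the `s, a, c` vocabulary of this line: `μ({s↔a} ∩ {s↔c})² ≤ 2·μ({s↔a} ∪ {c↔a})²·μ{s↔c}`.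
[cite: Gladkov2024, Thm. 6.2 (14) (p. 8)] -/
theorem sq_J_le_gladkov (w : Sym2 V → unitInterval) (s a c : V) :
    ((prodBernoulli w).real (openConn s a ∩ openConn s c)) ^ 2 ≤
      2 * ((prodBernoulli w).real (openConn s a ∪ openConn c a)) ^ 2 * (prodBernoulli w).real (openConn s c) := by
  have h := gladkov2024_thm_6_2_ineq14_prodBernoulli' w a s c
  have hJ : (openConn a s ∩ openConn a c : Set (BondConfig V)) = openConn s a ∩ openConn s c := by
    ext ω
    simp only [Set.mem_inter_iff, openConn, Set.mem_setOf_eq]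
    constructor
    · rintro ⟨h1, h2⟩; exact ⟨h1.symm, h1.symm.trans h2⟩
    · rintro ⟨h1, h2⟩; exact ⟨h1.symm, h1.symm.trans h2⟩
  have hsymm : ∀ x y : V, (openConn x y : Set (BondConfig V)) = openConn y x := fun x y =>
    Set.ext fun _ => ⟨fun h => SimpleGraph.Reachable.symm h, fun h => SimpleGraph.Reachable.symm h⟩
  have hU : (openConn a s ∪ openConn a c : Set (BondConfig V)) = openConn s a ∪ openConn c a := by
    rw [hsymm a s, hsymm a c]
  rw [hJ, hU] at h
  exact h

/-- **THE HALVING LEMMA (v) IN THE GLADKOV REGIME.**  On every finite weighted graph and for all vertices `s a c` with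
`μ{s ↔ c} ≤ 3 − 2√2`: `μ(U)·μ(D) ≤ 2·μ(U ∩ D)`, `U = {s↔a} ∪ {c↔a}`, `D = {s↮c}` — "conditioning on `s ↮ c` at most halves the
probability that `a` is joined to `{s, c}`".  From Gladkov's (14) [cite: Gladkov2024, Thm. 6.2 (14)] and `8σ ≤ (1+σ)²`. [this work] -/
theorem halvingUD_of_openConn_le (w : Sym2 V → unitInterval) (s a c : V)
    (hσ : (prodBernoulli w).real (openConn s c) ≤ 3 - 2 * Real.sqrt 2) :
    (prodBernoulli w).real (openConn s a ∪ openConn c a) * (prodBernoulli w).real ((openConn s c)ᶜ) ≤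
      2 * (prodBernoulli w).real ((openConn s a ∪ openConn c a) ∩ (openConn s c)ᶜ) :=
  halvingUD_of_sq_J_le w s a c (sq_J_le_gladkov w s a c) (eight_mul_le_of_le_three_sub _ hσ)

/-- (v) whenever `μ{s ↔ c} ≤ 1/6` (rational threshold). [this work] -/
theorem halvingUD_of_openConn_le_sixth (w : Sym2 V → unitInterval) (s a c : V)
    (hσ : (prodBernoulli w).real (openConn s c) ≤ 1 / 6) :
    (prodBernoulli w).real (openConn s a ∪ openConn c a) * (prodBernoulli w).real ((openConn s c)ᶜ) ≤
      2 * (prodBernoulli w).real ((openConn s a ∪ openConn c a) ∩ (openConn s c)ᶜ) :=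
  halvingUD_of_sq_J_le w s a c (sq_J_le_gladkov w s a c) (eight_mul_le_of_le_sixth _ hσ)

/-- **Cell form in the Gladkov regime**: `T·p₀ ≤ (1 + p₃)·(p₁ + p₂)` with `T = μ(sac) = μ({s↔a} ∩ {s↔c})`,
`p₀ = μ(s|a|c)`, `p₁ = μ({s↔a} ∖ {s↔c})`, `p₂ = μ({c↔a} ∖ {c↔s})`, `p₃ = μ({s↔c} ∖ {s↔a})`, whenever `μ{s↔c} ≤ 3 − 2√2`.
(The passage between the forms is the cell bookkeeping of `HalvingTransplant.halvingUD_of_blocked_le`, run backwards.) [this work] -/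
theorem halving_cells_of_openConn_le (w : Sym2 V → unitInterval) (s a c : V)
    (hσ : (prodBernoulli w).real (openConn s c) ≤ 3 - 2 * Real.sqrt 2) :
    (prodBernoulli w).real (openConn s a ∩ openConn s c) *
        (prodBernoulli w).real ((openConn s a)ᶜ ∩ (openConn s c)ᶜ ∩ (openConn c a)ᶜ) ≤
      (1 + (prodBernoulli w).real (openConn s c ∩ (openConn s a)ᶜ)) *
        ((prodBernoulli w).real (openConn s a ∩ (openConn s c)ᶜ) + (prodBernoulli w).real (openConn c a ∩ (openConn c s)ᶜ)) := by
  set μ := prodBernoulli w with hμ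
  have hv := halvingUD_of_openConn_le w s a c hσ
  have hX : μ.real ((openConn s a ∪ openConn c a) ∩ (openConn s c)ᶜ) =
      μ.real (openConn s a ∩ (openConn s c)ᶜ) + μ.real (openConn c a ∩ (openConn c s)ᶜ) := by
    rw [HalvingTransplant.inter_D_eq_union,
      measureReal_union (HalvingTransplant.disjoint_pairSep s a c) MeasurableSet.of_discrete]
  have hU : μ.real (openConn s a ∪ openConn c a) =
      μ.real ((openConn s a ∪ openConn c a) ∩ (openConn s c)ᶜ) + μ.real (openConn s a ∩ openConn s c) := by
    rw [← HalvingTransplant.inter_Dc_eq_J s a c,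
      ← measureReal_inter_add_sdiff₀ (s := openConn s a ∪ openConn c a) (t := (openConn s c)ᶜ)
      (MeasurableSet.of_discrete).nullMeasurableSet]
    congr 2
    ext ω; simp only [Set.mem_sdiff, Set.mem_compl_iff, not_not, Set.mem_inter_iff]
  have hD : μ.real ((openConn s c)ᶜ) =
      μ.real ((openConn s a ∪ openConn c a) ∩ (openConn s c)ᶜ) +
        μ.real ((openConn s a)ᶜ ∩ (openConn s c)ᶜ ∩ (openConn c a)ᶜ) := by
    rw [← HalvingTransplant.D_diff_U_eq_Z0 s a c, Set.inter_comm (openConn s a ∪ openConn c a),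
      ← measureReal_inter_add_sdiff₀ (s := (openConn s c)ᶜ) (t := openConn s a ∪ openConn c a)
      (MeasurableSet.of_discrete).nullMeasurableSet]
    congr 2
  have hDc : μ.real ((openConn s c)ᶜ) =
      1 - (μ.real (openConn s a ∩ openConn s c) + μ.real (openConn s c ∩ (openConn s a)ᶜ)) := by
    rw [measureReal_compl MeasurableSet.of_discrete, probReal_univ]
    congr 1
    conv_lhs => rw [HalvingTransplant.openConn_eq_J_union_SC s a c]
    rw [measureReal_union _ MeasurableSet.of_discrete]
    rw [Set.disjoint_left]
    rintro ω ⟨hsa, -⟩ ⟨-, hna⟩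
    exact hna hsa
  set X := μ.real ((openConn s a ∪ openConn c a) ∩ (openConn s c)ᶜ)
  set T := μ.real (openConn s a ∩ openConn s c)
  set P0 := μ.real ((openConn s a)ᶜ ∩ (openConn s c)ᶜ ∩ (openConn c a)ᶜ)
  set P3 := μ.real (openConn s c ∩ (openConn s a)ᶜ)
  have hX0 : 0 ≤ X := measureReal_nonneg
  rw [hU, hD] at hv
  have hD' : X + P0 = 1 - (T + P3) := by rw [← hD, hDc]
  rw [hX] at hv hD' hX0
  set x := μ.real (openConn s a ∩ (openConn s c)ᶜ) + μ.real (openConn c a ∩ (openConn c s)ᶜ) with hx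
  have key : x * (1 + P3) = x * (2 - x - P0 - T) := by
    have : 1 + P3 = 2 - x - P0 - T := by linarith
    rw [this]
  nlinarith [hv, key]

end HalvingRegime

end Summit.CriticalPhenomena.PercolationContinuityZ3.Theorems

end
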